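import Literature.Barriers.ResolutionOfSingularities.ResidualOrderUnbounded
import Mathlib.Algebra.MvPolynomial.Variables
import HarnessLib

/-!
# Point blow-ups and cleaning on supports and coefficients (toolkit for Hauser–Perlega's cycles)

`Literature/Barriers/ResolutionOfSingularities/ResidualOrderUnboundedBlowup.lean` — the generic
coefficient/support calculus behind the proof of the named fact
`HauserPerlega.HauserPerlega2019` of `ResidualOrderUnbounded.lean` (Hauser–Perlega 2019: the
residual order of `z^{pᵉ} + F(x) = 0` tends to infinity along a sequence of point blow-ups).

Hauser–Perlega track their examples through "unspecified units `A`, `B`, an arbitrary series `Q`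
and a constant `λ`" [cite: HauserPerlega2019, §4]. The Lean proof tracks instead the SUPPORT of
`F` (inside a finite union of translated orthants of exponent vectors) and the COEFFICIENTS of
finitely many key monomials; this file provides the rules moving such data through one step
`F ↦ (x_j^{−q} π(F))_clean` (`blowupStep q j t F = deletePthPowers q (transformResidual q j t F)`,
the right-hand side of `IsPointBlowupSequence.transform`). Throughout, `T ∌ j` is a finite set of
variables containing the translated ones (`tᵢ = 0` for `i ∉ T`).

* `totalTransform_monomial`, `transformResidual_monomial`: the transform of a monomial `c·x^e`
  (`|e| ≥ q`) under the point blow-up `π` (`x_j`-chart, translations `t`) is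
  `c · x^{base e} · ∏_{i ∈ T} (xᵢ + tᵢ)^{eᵢ}` with `base e = (|e| − q)·δ_j + e|_{i ∉ T, i ≠ j}`
  [cite: HauserPerlega2019, §2 (`F' = x_j^{−pᵉ} π(F)`)];
* `exists_produces_of_mem_support(_blowupStep)`: every monomial `x^{e'}` of the (cleaned)
  transform of `F` is produced by a monomial `x^e` of `F` with `|e| = e'_j + q` and `e'ᵢ = eᵢ`
  for `i ∉ T`, `i ≠ j` (`Produces`);
* `coeff_base_transformResidual`, `coeff_base_blowupStep`: if `x^{e₀}` is the only monomial of
  `F` that can produce `x^{base e₀}`, its coefficient is carried over (times `∏_{i∈T} tᵢ^{e₀ i}`);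
  `coeff_blowupStep_eq_zero`: no producer, no coefficient;
* cleaning: `isClean_blowupStep`; `IsQthPowerSupported` (all monomials `q`-th powers: deleted
  entirely, `IsQthPowerSupported.deletePthPowers_eq_zero`), while `P · x^d` with `x^d` not a
  `q`-th power survives untouched (`deletePthPowers_mul_monomial`); the Frobenius identity
  `(xᵢ + c)^{pᵏ m} = (xᵢ^{pᵏ} + c^{pᵏ})^m` (`X_add_C_pow_mul`) used to expand the translated
  factors of the `λ`-term.

Orders, residual orders, the generated sequence and the renaming symmetry are in
`ResidualOrderUnboundedBounds.lean`. Everything here is elementary algebra of `MvPolynomial`,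
tagged `[folklore]` unless it transcribes a formula of the source.
-/

noncomputable section

open MvPolynomial Finset

open scoped BigOperators

namespace Literature.Barriers.ResolutionOfSingularities

open Literature.AlgebraicGeometry.Resolution.Hauser2010

namespace HauserPerlega

section Clean

variable {σ : Type*} [DecidableEq σ] {K : Type*} [CommRing K]

/-- One step of a point blow-up sequence: `F ↦ (x_j^{−q} π(F))_clean`, the cleaned `F`-part of the
strict transform (`IsPointBlowupSequence.transform`). [cite: HauserPerlega2019, §2] -/
def blowupStep (q : ℕ) (j : σ) (t : σ → K) (F : MvPolynomial σ K) : MvPolynomial σ K :=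
  deletePthPowers q (transformResidual q j t F)

/-- Unfolding `blowupStep`. [folklore] -/
theorem blowupStep_def (q : ℕ) (j : σ) (t : σ → K) (F : MvPolynomial σ K) :
    blowupStep q j t F = deletePthPowers q (transformResidual q j t F) := rfl

/-- The result of deleting the `q`-th power monomials is clean. [folklore] -/
theorem isClean_deletePthPowers (q : ℕ) (G : MvPolynomial σ K) : IsClean q (deletePthPowers q G) := by
  intro d hd h
  rw [MvPolynomial.mem_support_iff, coeff_deletePthPowers, if_pos h] at hd
  exact hd rfl

/-- `blowupStep` produces clean polynomials. [folklore] -/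
theorem isClean_blowupStep (q : ℕ) (j : σ) (t : σ → K) (F : MvPolynomial σ K) :
    IsClean q (blowupStep q j t F) :=
  isClean_deletePthPowers q _

/-- Coefficients of `blowupStep`. [folklore] -/
theorem coeff_blowupStep (q : ℕ) (j : σ) (t : σ → K) (F : MvPolynomial σ K) (e : σ →₀ ℕ) :
    coeff e (blowupStep q j t F) =
      if IsPthPowerExponent q e then 0 else coeff e (transformResidual q j t F) := by
  rw [blowupStep, coeff_deletePthPowers]

/-- A monomial surviving the cleaning is not a `q`-th power and was there before. [folklore] -/
theorem mem_support_deletePthPowers {q : ℕ} {G : MvPolynomial σ K} {e : σ →₀ ℕ}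
    (he : e ∈ (deletePthPowers q G).support) : ¬ IsPthPowerExponent q e ∧ e ∈ G.support := by
  rw [MvPolynomial.mem_support_iff, coeff_deletePthPowers] at he
  by_cases h : IsPthPowerExponent q e
  · simp [h] at he
  · exact ⟨h, MvPolynomial.mem_support_iff.mpr (by simpa [h] using he)⟩

/-! ### Linearity of the transform -/

/-- `transformResidual` is additive. [folklore] -/
theorem transformResidual_add (q : ℕ) (j : σ) (t : σ → K) (F G : MvPolynomial σ K) :
    transformResidual q j t (F + G) = transformResidual q j t F + transformResidual q j t G := by
  simp only [transformResidual, totalTransform, map_add, add_divMonomial]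

/-- `transformResidual 0 = 0`. [folklore] -/
theorem transformResidual_zero (q : ℕ) (j : σ) (t : σ → K) :
    transformResidual q j t (0 : MvPolynomial σ K) = 0 := by
  simp only [transformResidual, totalTransform, map_zero, zero_divMonomial]

/-- `transformResidual` of a finite sum. [folklore] -/
theorem transformResidual_sum {ι : Type*} (q : ℕ) (j : σ) (t : σ → K) (s : Finset ι)
    (F : ι → MvPolynomial σ K) :
    transformResidual q j t (∑ i ∈ s, F i) = ∑ i ∈ s, transformResidual q j t (F i) := by
  classical
  induction s using Finset.induction_on with
  | empty => simp [transformResidual_zero]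
  | insert a s ha ih => rw [Finset.sum_insert ha, Finset.sum_insert ha, transformResidual_add, ih]

/-- `blowupStep` is additive. [folklore] -/
theorem blowupStep_add (q : ℕ) (j : σ) (t : σ → K) (F G : MvPolynomial σ K) :
    blowupStep q j t (F + G) = blowupStep q j t F + blowupStep q j t G := by
  rw [blowupStep, transformResidual_add, deletePthPowers_add, ← blowupStep, ← blowupStep]

/-- The variables of `xᵢ + c` are among `{i}`. [folklore] -/
theorem vars_X_add_C_subset (i : σ) (c : K) : (X i + C c : MvPolynomial σ K).vars ⊆ {i} := by
  intro k hk
  rw [mem_vars_iff_mem_support] at hk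
  obtain ⟨d, hd, hkd⟩ := hk
  have hd' := support_add hd
  rw [Finset.mem_union] at hd'
  rcases hd' with h | h
  · have := support_monomial_subset (show d ∈ (monomial (Finsupp.single i 1) (1 : K)).support by
      rwa [← X_pow_eq_monomial, pow_one])
    rw [Finset.mem_singleton] at this
    subst this
    exact Finset.mem_singleton.mpr (Finset.mem_singleton.mp (Finsupp.support_single_subset hkd))
  · have := support_monomial_subset (show d ∈ (monomial (0 : σ →₀ ℕ) c).support from h)
    rw [Finset.mem_singleton] at this
    subst this
    simp at hkd

end Clean

section Base

variable {σ : Type*} [DecidableEq σ] {K : Type*} [CommRing K]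

/-- The exponent `base e = (|e| − q)·δ_j + e|_{i ∉ T, i ≠ j}` of the leading monomial of the
transform of `x^e` (`T ∌ j` a set of variables containing the translated ones): the `x_j`-exponent
becomes `|e| − q`, untranslated variables keep their exponent, those of `T` are set to `0`.
[folklore] -/
def base (q : ℕ) (j : σ) (T : Finset σ) (e : σ →₀ ℕ) : σ →₀ ℕ :=
  Finsupp.single j (e.degree - q) + e.filter (fun i => i ≠ j ∧ i ∉ T)

/-- Coordinates of `base`. [folklore] -/
theorem base_apply (q : ℕ) (j : σ) (T : Finset σ) (e : σ →₀ ℕ) (i : σ) :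
    base q j T e i = if i = j then e.degree - q else if i ∈ T then 0 else e i := by
  unfold base
  rw [Finsupp.add_apply, Finsupp.filter_apply, Finsupp.single_apply]
  by_cases hij : i = j
  · subst hij; simp
  · by_cases hti : i ∈ T
    · simp [hij, hti, Ne.symm hij]
    · simp [hij, hti, Ne.symm hij]

/-- `base e` at `j`. [folklore] -/
@[simp] theorem base_apply_self (q : ℕ) (j : σ) (T : Finset σ) (e : σ →₀ ℕ) :
    base q j T e j = e.degree - q := by
  simp [base_apply]

/-- `base e` at an untranslated `i ≠ j`. [folklore] -/
theorem base_apply_of_not_mem (q : ℕ) {j : σ} {T : Finset σ} (e : σ →₀ ℕ) {i : σ} (hij : i ≠ j)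
    (hti : i ∉ T) : base q j T e i = e i := by
  simp [base_apply, hij, hti]

/-- `base e` vanishes on `T` (when `j ∉ T`). [folklore] -/
theorem base_apply_of_mem (q : ℕ) {j : σ} {T : Finset σ} (hj : j ∉ T) (e : σ →₀ ℕ) {i : σ}
    (hti : i ∈ T) : base q j T e i = 0 := by
  have hij : i ≠ j := fun h => hj (h ▸ hti)
  simp [base_apply, hij, hti]

/-- The translated factor `∏_{i ∈ T} (xᵢ + tᵢ)^{eᵢ}` of the transform of `x^e`. [folklore] -/
def transFactor (T : Finset σ) (t : σ → K) (e : σ →₀ ℕ) : MvPolynomial σ K :=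
  ∏ i ∈ T, (X i + C (t i)) ^ (e i)

/-- The variables of the translated factor lie in `T`. [folklore] -/
theorem vars_transFactor_subset (T : Finset σ) (t : σ → K) (e : σ →₀ ℕ) :
    (transFactor T t e).vars ⊆ T := by
  unfold transFactor
  refine (vars_prod _).trans (Finset.biUnion_subset.mpr fun i hi => ?_)
  refine (vars_pow _ _).trans ((vars_X_add_C_subset i (t i)).trans ?_)
  exact Finset.singleton_subset_iff.mpr hi

omit [DecidableEq σ] in
/-- The constant coefficient of the translated factor is `∏_{i∈T} tᵢ^{eᵢ}`. [folklore] -/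
theorem constantCoeff_transFactor (T : Finset σ) (t : σ → K) (e : σ →₀ ℕ) :
    constantCoeff (transFactor T t e) = ∏ i ∈ T, t i ^ (e i) := by
  unfold transFactor
  rw [map_prod]
  refine Finset.prod_congr rfl fun i _ => ?_
  rw [map_pow, map_add, constantCoeff_X, constantCoeff_C, zero_add]

/-! ### Which monomials of `F` produce a given monomial of the transform -/

/-- `x^e` **can produce** `x^{e'}` under the blow-up step (`x_j`-chart, translated variables in `T`):
`|e| = e'_j + q` and `e'ᵢ = eᵢ` for every untranslated `i ≠ j`. [folklore] -/
def Produces (q : ℕ) (j : σ) (T : Finset σ) (e e' : σ →₀ ℕ) : Prop :=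
  e.degree = e' j + q ∧ ∀ i, i ∉ T → i ≠ j → e' i = e i

/-- `x^e` produces `x^{base e}` (if `|e| ≥ q`). [folklore] -/
theorem produces_base {q : ℕ} {j : σ} {T : Finset σ} {e : σ →₀ ℕ} (he : q ≤ e.degree) :
    Produces q j T e (base q j T e) :=
  ⟨by rw [base_apply_self, Nat.sub_add_cancel he], fun _ hi hij => base_apply_of_not_mem q e hij hi⟩

/-- A monomial of `c·x^{base e} · ∏_{i∈T}(xᵢ + tᵢ)^{eᵢ}` is produced by `x^e`. [folklore] -/
theorem produces_of_coeff_monomial_base_mul_ne_zero {q : ℕ} {j : σ} {T : Finset σ} (hj : j ∉ T)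
    {t : σ → K} {e e' : σ →₀ ℕ} (he : q ≤ e.degree) {c : K}
    (h : coeff e' (monomial (base q j T e) c * transFactor T t e) ≠ 0) :
    Produces q j T e e' := by
  rw [coeff_monomial_mul'] at h
  split_ifs at h with hle
  · have hmem : e' - base q j T e ∈ (transFactor T t e).support := by
      rw [MvPolynomial.mem_support_iff]
      exact fun h0 => h (by rw [h0, mul_zero])
    have hzero : ∀ i, i ∉ T → (e' - base q j T e) i = 0 := by
      intro i hi
      by_contra hne
      have : i ∈ (transFactor T t e).vars :=
        (mem_vars_iff_mem_support i).mpr ⟨_, hmem, Finsupp.mem_support_iff.mpr hne⟩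
      exact hi (vars_transFactor_subset T t e this)
    have heq : ∀ i, i ∉ T → e' i = base q j T e i := by
      intro i hi
      have h1 := hzero i hi
      have h2 : base q j T e i ≤ e' i := hle i
      rw [Finsupp.tsub_apply] at h1
      omega
    refine ⟨?_, fun i hi hij => ?_⟩
    · rw [heq j hj, base_apply_self, Nat.sub_add_cancel he]
    · rw [heq i hi, base_apply_of_not_mem q e hij hi]
  · exact absurd rfl h

end Base

section Step

variable {σ : Type*} [Fintype σ] [DecidableEq σ] {K : Type*} [CommRing K]

/-! ### The transform of a monomial -/

/-- **Total transform of a monomial**: `π(c·x^e) = c · x_j^{|e|} · ∏_{i ≠ j} (xᵢ + tᵢ)^{eᵢ}`.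
[cite: HauserPerlega2019, §2 (the map π)] -/
theorem totalTransform_monomial (j : σ) (t : σ → K) (e : σ →₀ ℕ) (c : K) :
    totalTransform j t (monomial e c) =
      C c * X j ^ e.degree * ∏ i ∈ univ.erase j, (X i + C (t i)) ^ (e i) := by
  unfold totalTransform
  rw [aeval_monomial, Finsupp.prod_fintype _ _ (fun i => pow_zero _), algebraMap_eq,
    ← Finset.mul_prod_erase univ _ (mem_univ j)]
  have h : ∏ i ∈ univ.erase j, pointBlowupSubst j t i ^ (e i) =
      ∏ i ∈ univ.erase j, (X j ^ (e i) * (X i + C (t i)) ^ (e i)) := by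
    refine Finset.prod_congr rfl fun i hi => ?_
    rw [Finset.mem_erase] at hi
    simp [pointBlowupSubst, hi.1, mul_pow]
  rw [h, Finset.prod_mul_distrib, Finset.prod_pow_eq_pow_sum, Finsupp.degree_eq_sum,
    ← Finset.add_sum_erase univ _ (mem_univ j)]
  simp only [pointBlowupSubst, if_true]
  ring

/-- `c · x^{base e} = c · x_j^{|e| - q} · ∏_{i ∉ T, i ≠ j} xᵢ^{eᵢ}`. [folklore] -/
theorem monomial_base (q : ℕ) (j : σ) (T : Finset σ) (e : σ →₀ ℕ) (c : K) :
    monomial (base q j T e) c =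
      C c * X j ^ (e.degree - q) * ∏ i ∈ univ.filter (fun i => i ≠ j ∧ i ∉ T), X i ^ (e i) := by
  unfold base
  have hsub : (e.filter (fun i => i ≠ j ∧ i ∉ T)).support ⊆ univ.filter (fun i => i ≠ j ∧ i ∉ T) := by
    intro i hi
    rw [Finsupp.support_filter, Finset.mem_filter] at hi
    exact Finset.mem_filter.mpr ⟨mem_univ _, hi.2⟩
  have hprod : (e.filter (fun i => i ≠ j ∧ i ∉ T)).prod (fun n k => (X n : MvPolynomial σ K) ^ k) =
      ∏ i ∈ univ.filter (fun i => i ≠ j ∧ i ∉ T), X i ^ (e i) := by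
    rw [Finsupp.prod_of_support_subset _ hsub _ (fun i _ => pow_zero _)]
    exact Finset.prod_congr rfl (fun i hi => by
      rw [Finset.mem_filter] at hi
      rw [Finsupp.filter_apply, if_pos hi.2])
  rw [monomial_single_add, monomial_eq, hprod]
  ring

/-- **Transform of a monomial**: for `|e| ≥ q`, `j ∉ T`, `tᵢ = 0` off `T`,
`x_j^{−q} π(c·x^e) = c · x^{base e} · ∏_{i ∈ T} (xᵢ + tᵢ)^{eᵢ}`.
[cite: HauserPerlega2019, §2 (`F' = x_j^{−pᵉ} π(F)`)] -/
theorem transformResidual_monomial {q : ℕ} {j : σ} {T : Finset σ} {t : σ → K} (hj : j ∉ T)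
    (ht : ∀ i, i ∉ T → i ≠ j → t i = 0) {e : σ →₀ ℕ} (he : q ≤ e.degree) (c : K) :
    transformResidual q j t (monomial e c) = monomial (base q j T e) c * transFactor T t e := by
  unfold transformResidual
  rw [totalTransform_monomial]
  have hA : (univ.erase j).filter (fun i => i ∉ T) = univ.filter (fun i => i ≠ j ∧ i ∉ T) := by
    ext i; simp [Finset.mem_erase]
  have hB : (univ.erase j).filter (fun i => ¬ i ∉ T) = T := by
    ext i
    simp only [not_not, Finset.mem_filter, Finset.mem_erase, mem_univ, and_true]
    exact ⟨fun h => h.2, fun h => ⟨fun hij => hj (hij ▸ h), h⟩⟩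
  have hsplit : ∏ i ∈ univ.erase j, (X i + C (t i)) ^ (e i) =
      (∏ i ∈ univ.filter (fun i => i ≠ j ∧ i ∉ T), X i ^ (e i)) * transFactor T t e := by
    rw [← Finset.prod_filter_mul_prod_filter_not (univ.erase j) (fun i => i ∉ T), hA, hB]
    unfold transFactor
    congr 1
    refine Finset.prod_congr rfl fun i hi => ?_
    rw [Finset.mem_filter] at hi
    rw [ht i hi.2.2 hi.2.1, C_0, add_zero]
  rw [hsplit]
  have hX : (X j : MvPolynomial σ K) ^ e.degree =
      monomial (Finsupp.single j q) 1 * X j ^ (e.degree - q) := by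
    rw [X_pow_eq_monomial, X_pow_eq_monomial, monomial_mul, one_mul, ← Finsupp.single_add,
      Nat.add_sub_cancel' he]
  rw [hX, show C c * (monomial (Finsupp.single j q) 1 * X j ^ (e.degree - q)) *
      ((∏ i ∈ univ.filter (fun i => i ≠ j ∧ i ∉ T), X i ^ (e i)) * transFactor T t e) =
      monomial (Finsupp.single j q) 1 * ((C c * X j ^ (e.degree - q) *
        ∏ i ∈ univ.filter (fun i => i ≠ j ∧ i ∉ T), X i ^ (e i)) * transFactor T t e) by ring,
    divMonomial_monomial_mul, ← monomial_base]

/-- **Every monomial of the transform is produced by a monomial of `F`.** [folklore] -/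
theorem exists_produces_of_mem_support {q : ℕ} {j : σ} {T : Finset σ} {t : σ → K} (hj : j ∉ T)
    (ht : ∀ i, i ∉ T → i ≠ j → t i = 0) {F : MvPolynomial σ K}
    (hF : ∀ e ∈ F.support, q ≤ e.degree) {e' : σ →₀ ℕ}
    (he' : e' ∈ (transformResidual q j t F).support) :
    ∃ e ∈ F.support, Produces q j T e e' := by
  rw [MvPolynomial.mem_support_iff, F.as_sum, transformResidual_sum, coeff_sum] at he'
  obtain ⟨e, he, hne⟩ := Finset.exists_ne_zero_of_sum_ne_zero he'
  refine ⟨e, he, ?_⟩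
  rw [transformResidual_monomial hj ht (hF e he)] at hne
  exact produces_of_coeff_monomial_base_mul_ne_zero hj (hF e he) hne

/-- The same for the cleaned transform `blowupStep`, which moreover has no `q`-th powers. [folklore] -/
theorem exists_produces_of_mem_support_blowupStep {q : ℕ} {j : σ} {T : Finset σ} {t : σ → K}
    (hj : j ∉ T) (ht : ∀ i, i ∉ T → i ≠ j → t i = 0) {F : MvPolynomial σ K}
    (hF : ∀ e ∈ F.support, q ≤ e.degree) {e' : σ →₀ ℕ}
    (he' : e' ∈ (blowupStep q j t F).support) :
    ¬ IsPthPowerExponent q e' ∧ ∃ e ∈ F.support, Produces q j T e e' := by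
  obtain ⟨h1, h2⟩ := mem_support_deletePthPowers he'
  exact ⟨h1, exists_produces_of_mem_support hj ht hF h2⟩

/-- If no monomial of `F` can produce `x^{e'}`, its coefficient in the transform vanishes. [folklore] -/
theorem coeff_transformResidual_eq_zero {q : ℕ} {j : σ} {T : Finset σ} {t : σ → K} (hj : j ∉ T)
    (ht : ∀ i, i ∉ T → i ≠ j → t i = 0) {F : MvPolynomial σ K}
    (hF : ∀ e ∈ F.support, q ≤ e.degree) {e' : σ →₀ ℕ}
    (hno : ∀ e ∈ F.support, ¬ Produces q j T e e') :
    coeff e' (transformResidual q j t F) = 0 := by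
  by_contra hne
  obtain ⟨e, he, hp⟩ := exists_produces_of_mem_support hj ht hF (MvPolynomial.mem_support_iff.mpr hne)
  exact hno e he hp

/-- **Key coefficients are carried over.** If `x^{e₀}` is the only monomial of `F` that can produce
`x^{base e₀}`, then the coefficient of `x^{base e₀}` in `x_j^{−q}π(F)` is
`coeff_{e₀} F · ∏_{i ∈ T} tᵢ^{e₀ i}`. [folklore] -/
theorem coeff_base_transformResidual {q : ℕ} {j : σ} {T : Finset σ} {t : σ → K} (hj : j ∉ T)
    (ht : ∀ i, i ∉ T → i ≠ j → t i = 0) {F : MvPolynomial σ K}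
    (hF : ∀ e ∈ F.support, q ≤ e.degree) {e₀ : σ →₀ ℕ} (he₀ : q ≤ e₀.degree)
    (huniq : ∀ e ∈ F.support, Produces q j T e (base q j T e₀) → e = e₀) :
    coeff (base q j T e₀) (transformResidual q j t F) = coeff e₀ F * ∏ i ∈ T, t i ^ (e₀ i) := by
  rw [F.as_sum, transformResidual_sum, coeff_sum, coeff_sum]
  rw [Finset.sum_mul]
  refine Finset.sum_congr rfl fun e he => ?_
  rw [transformResidual_monomial hj ht (hF e he), coeff_monomial]
  by_cases hee : e = e₀
  · subst hee
    rw [if_pos rfl, coeff_monomial_mul', if_pos le_rfl, tsub_self, ← constantCoeff_eq,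
      constantCoeff_transFactor]
  · rw [if_neg hee, zero_mul]
    by_contra hne
    exact hee (huniq e he (produces_of_coeff_monomial_base_mul_ne_zero hj (hF e he) hne))

/-- The same for `blowupStep`, when `x^{base e₀}` is not a `q`-th power. [folklore] -/
theorem coeff_base_blowupStep {q : ℕ} {j : σ} {T : Finset σ} {t : σ → K} (hj : j ∉ T)
    (ht : ∀ i, i ∉ T → i ≠ j → t i = 0) {F : MvPolynomial σ K}
    (hF : ∀ e ∈ F.support, q ≤ e.degree) {e₀ : σ →₀ ℕ} (he₀ : q ≤ e₀.degree)
    (huniq : ∀ e ∈ F.support, Produces q j T e (base q j T e₀) → e = e₀)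
    (hpow : ¬ IsPthPowerExponent q (base q j T e₀)) :
    coeff (base q j T e₀) (blowupStep q j t F) = coeff e₀ F * ∏ i ∈ T, t i ^ (e₀ i) := by
  rw [coeff_blowupStep, if_neg hpow, coeff_base_transformResidual hj ht hF he₀ huniq]

/-- If no monomial of `F` can produce `x^{e'}`, its coefficient in `blowupStep F` vanishes. [folklore] -/
theorem coeff_blowupStep_eq_zero {q : ℕ} {j : σ} {T : Finset σ} {t : σ → K} (hj : j ∉ T)
    (ht : ∀ i, i ∉ T → i ≠ j → t i = 0) {F : MvPolynomial σ K}
    (hF : ∀ e ∈ F.support, q ≤ e.degree) {e' : σ →₀ ℕ}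
    (hno : ∀ e ∈ F.support, ¬ Produces q j T e e') :
    coeff e' (blowupStep q j t F) = 0 := by
  rw [coeff_blowupStep, coeff_transformResidual_eq_zero hj ht hF hno, ite_self]

end Step

section QthPowers

variable {σ : Type*} [DecidableEq σ] {K : Type*} [CommRing K]

/-! ### Polynomials all of whose monomials are `q`-th powers (the part deleted by cleaning) -/

/-- All monomials of `P` are `q`-th power monomials (over a perfect field of characteristic `p`,
`q = pᵉ`: `P` is a `q`-th power); cleaning deletes exactly such terms. [cite: HauserPerlega2019, §2 (cleaning)] -/
def IsQthPowerSupported (q : ℕ) (P : MvPolynomial σ K) : Prop :=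
  ∀ e ∈ P.support, IsPthPowerExponent q e

omit [DecidableEq σ] in
/-- A monomial with `q`-th power exponent. [folklore] -/
theorem isQthPowerSupported_monomial {q : ℕ} {e : σ →₀ ℕ} (he : IsPthPowerExponent q e) (c : K) :
    IsQthPowerSupported q (monomial e c) := by
  intro d hd
  have := support_monomial_subset hd
  rw [Finset.mem_singleton] at this
  rwa [this]

omit [DecidableEq σ] in
/-- Constants. [folklore] -/
theorem isQthPowerSupported_C (q : ℕ) (c : K) : IsQthPowerSupported q (C c : MvPolynomial σ K) :=
  isQthPowerSupported_monomial (by rw [isPthPowerExponent_iff]; intro i; simp) c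

omit [DecidableEq σ] in
/-- `1`. [folklore] -/
theorem isQthPowerSupported_one (q : ℕ) : IsQthPowerSupported q (1 : MvPolynomial σ K) := by
  simpa using isQthPowerSupported_C (σ := σ) q (1 : K)

omit [DecidableEq σ] in
/-- `xᵢ^q`. [folklore] -/
theorem isQthPowerSupported_X_pow (q : ℕ) (i : σ) : IsQthPowerSupported q ((X i : MvPolynomial σ K) ^ q) := by
  rw [X_pow_eq_monomial]
  refine isQthPowerSupported_monomial ?_ 1
  rw [isPthPowerExponent_iff]
  intro k
  classical
  rw [Finsupp.single_apply]
  split_ifs <;> simp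

/-- Sums. [folklore] -/
theorem IsQthPowerSupported.add {q : ℕ} {P Q : MvPolynomial σ K} (hP : IsQthPowerSupported q P)
    (hQ : IsQthPowerSupported q Q) : IsQthPowerSupported q (P + Q) := by
  intro e he
  rcases Finset.mem_union.mp (support_add he) with h | h
  · exact hP e h
  · exact hQ e h

/-- Products. [folklore] -/
theorem IsQthPowerSupported.mul {q : ℕ} {P Q : MvPolynomial σ K} (hP : IsQthPowerSupported q P)
    (hQ : IsQthPowerSupported q Q) : IsQthPowerSupported q (P * Q) := by
  intro e he
  obtain ⟨a, ha, b, hb, rfl⟩ := Finset.mem_add.mp (support_mul P Q he)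
  rw [isPthPowerExponent_iff]
  intro i
  rw [Finsupp.add_apply]
  exact dvd_add ((isPthPowerExponent_iff q a).mp (hP a ha) i) ((isPthPowerExponent_iff q b).mp (hQ b hb) i)

/-- Powers. [folklore] -/
theorem IsQthPowerSupported.pow {q : ℕ} {P : MvPolynomial σ K} (hP : IsQthPowerSupported q P) (n : ℕ) :
    IsQthPowerSupported q (P ^ n) := by
  induction n with
  | zero => simpa using isQthPowerSupported_one (σ := σ) (K := K) q
  | succ n ih => rw [pow_succ]; exact ih.mul hP

/-- Cleaning deletes a `q`-th power supported polynomial entirely. [cite: HauserPerlega2019, §2 (cleaning)] -/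
theorem IsQthPowerSupported.deletePthPowers_eq_zero {q : ℕ} {P : MvPolynomial σ K}
    (hP : IsQthPowerSupported q P) : deletePthPowers q P = 0 := by
  ext e
  rw [coeff_deletePthPowers, coeff_zero]
  split_ifs with h
  · rfl
  · by_contra hne
    exact h (hP e (MvPolynomial.mem_support_iff.mpr hne))

omit [DecidableEq σ] in
/-- A polynomial without `q`-th power monomials is untouched by cleaning. [folklore] -/
theorem deletePthPowers_eq_self {q : ℕ} {P : MvPolynomial σ K}
    (hP : ∀ e ∈ P.support, ¬ IsPthPowerExponent q e) : deletePthPowers q P = P := by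
  classical
  ext e
  rw [coeff_deletePthPowers]
  split_ifs with h
  · by_contra hne
    exact hP e (MvPolynomial.mem_support_iff.mpr (Ne.symm hne)) h
  · rfl

/-- Monomials of `P · c x^d` are `a + d` with `x^a` a monomial of `P`. [folklore] -/
theorem exists_add_of_mem_support_mul_monomial {P : MvPolynomial σ K} {d e : σ →₀ ℕ} {c : K}
    (he : e ∈ (P * monomial d c).support) : ∃ a ∈ P.support, e = a + d := by
  obtain ⟨a, ha, b, hb, rfl⟩ := Finset.mem_add.mp (support_mul P _ he)
  have hb' := support_monomial_subset hb
  rw [Finset.mem_singleton] at hb'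
  subst hb'
  exact ⟨a, ha, rfl⟩

/-- Monomials of `P · c x^d` with `P` `q`-th power supported are `a + d`, `a` a `q`-th power
exponent. [folklore] -/
theorem IsQthPowerSupported.exists_of_mem_support_mul_monomial {q : ℕ} {P : MvPolynomial σ K}
    (hP : IsQthPowerSupported q P) {d e : σ →₀ ℕ} {c : K}
    (he : e ∈ (P * monomial d c).support) : ∃ a, IsPthPowerExponent q a ∧ e = a + d := by
  obtain ⟨a, ha, rfl⟩ := exists_add_of_mem_support_mul_monomial he
  exact ⟨a, hP a ha, rfl⟩

omit [DecidableEq σ] in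
/-- A variable not occurring in `P` has exponent `0` in every monomial of `P`. [folklore] -/
theorem apply_eq_zero_of_not_mem_vars [DecidableEq σ] {P : MvPolynomial σ K} {d : σ →₀ ℕ}
    (hd : d ∈ P.support) {i : σ} (hi : i ∉ P.vars) : d i = 0 := by
  by_contra h
  exact hi ((mem_vars_iff_mem_support i).mpr ⟨d, hd, Finsupp.mem_support_iff.mpr h⟩)

/-- The variables of `xᵢ^n + c` are among `{i}`. [folklore] -/
theorem vars_X_pow_add_C_subset (i : σ) (n : ℕ) (c : K) :
    ((X i : MvPolynomial σ K) ^ n + C c).vars ⊆ {i} := by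
  refine (vars_add_subset _ _).trans (Finset.union_subset ((vars_pow _ _).trans ?_) ?_)
  · have h := vars_X_add_C_subset (K := K) i 0
    rwa [C_0, add_zero] at h
  · rw [vars_C]; exact Finset.empty_subset _

/-- `P · c x^d` with `P` `q`-th power supported and `x^d` NOT a `q`-th power survives the cleaning
unchanged. [cite: HauserPerlega2019, §2 (cleaning)] -/
theorem IsQthPowerSupported.deletePthPowers_mul_monomial {q : ℕ} {P : MvPolynomial σ K}
    (hP : IsQthPowerSupported q P) {d : σ →₀ ℕ} (hd : ¬ IsPthPowerExponent q d) (c : K) :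
    deletePthPowers q (P * monomial d c) = P * monomial d c := by
  refine deletePthPowers_eq_self fun e he hpow => ?_
  obtain ⟨a, ha, rfl⟩ := hP.exists_of_mem_support_mul_monomial he
  apply hd
  rw [isPthPowerExponent_iff] at ha hpow ⊢
  intro i
  have h1 := ha i
  have h2 := hpow i
  rw [Finsupp.add_apply] at h2
  exact (Nat.dvd_add_right h1).mp h2

omit [DecidableEq σ] in
/-- In characteristic `p`, `(xᵢ + c)^{pᵏ·m} = (xᵢ^{pᵏ} + c^{pᵏ})^m`. [folklore] -/
theorem X_add_C_pow_mul {p : ℕ} [Fact p.Prime] [CharP K p] (i : σ) (c : K) (k m : ℕ) :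
    ((X i + C c : MvPolynomial σ K) ^ (p ^ k * m)) = (X i ^ p ^ k + C (c ^ p ^ k)) ^ m := by
  have : CharP (MvPolynomial σ K) p := inferInstance
  rw [pow_mul, add_pow_char_pow, ← map_pow]

omit [DecidableEq σ] in
/-- `(xᵢ^q + c)^m` is `q`-th power supported. [folklore] -/
theorem isQthPowerSupported_X_pow_add_C_pow (q : ℕ) (i : σ) (c : K) (m : ℕ) :
    IsQthPowerSupported q ((X i ^ q + C c : MvPolynomial σ K) ^ m) := by
  classical
  exact ((isQthPowerSupported_X_pow q i).add (isQthPowerSupported_C q c)).pow m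

end QthPowers

end HauserPerlega

end Literature.Barriers.ResolutionOfSingularities
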